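import Mathlib
import Summits.ValiantsHypothesis.ValiantsHypothesis.Theorems.LacunarySymmetroidMatrixDescartesDefiniteMomentsZonesInterlacing

/-!
# `MatrixDescartes` (stmt-ValiantsHypothesis-18050) — the DEFINITE-MOMENTS LAW, zones EXACT V: lacunary Cauchy interlacing,
# mirror orientation and the packaging on the gaps of `K` alternating definite scales

HONEST FRAMING.  Cell `pub-symmetroid`, seat `val-sym-mdr-p2` (gen 16); helper file `--supports` the crux
`Theses.LacunarySymmetroid.MatrixDescartes`, NO closure claim.  Companion of `…DefiniteMomentsZonesInterlacing`; a sector law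
beside the crux; nothing here bears on the crux in its window, on `stub_twoSided`, on `DoorA26`/`DoorA34`, registers, or
`VP ≠ VNP`.

CONTENT.  (§1) Mirror window `F(a) ≺ 0 ≺ F(b)`: `posIndex_eq_sum_corank_upTo` (the POSITIVE index counts the roots in
`(a, x)` by kernel dimension), `card_roots_upTo_eq_posIndex`.  (§2) `posIndex_submatrix_interlace` (static inclusion principle
for the positive index).  (§3) `card_roots_upTo_interlace'` (interlacing with multiplicity, mirror orientation).
(§4) **`card_roots_gap_upTo_interlace`** — on the intrinsic hyperbolic sector given by `K` alternating definite scales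
`0 < a₀ < ⋯ < a_{K−1}`, for every gap `(aⱼ, aⱼ₊₁)`, every scale `x ∈ (aⱼ, aⱼ₊₁]` and every principal compression `G = F[e,e]`
(`e : κ' ↪ ι`): the numbers `N_G`, `N_F` of roots of `det G`, `det F` in `(aⱼ, x)` counted with multiplicity satisfy
`N_G ≤ N_F ≤ N_G + (card ι − card κ')` — LACUNARY CAUCHY INTERLACING ON THE SECTOR (the roots of a codimension-one compression
separate those of `det F`, zone by zone, in counting form). [folklore] (Markus 1988 §31; Horn–Johnson Thm 4.3.28); axioms
standard; no definitions.
-/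

-- layout Summits/ValiantsHypothesis/ValiantsHypothesis forces the duplicated namespace component
set_option linter.dupNamespace false

namespace Summit.ValiantsHypothesis.ValiantsHypothesis.Theorems.LacunarySymmetroidMatrixDescartes

open Polynomial Matrix Finset
open scoped BigOperators Topology

namespace DefiniteMoments

variable {ι : Type} [Fintype ι] [DecidableEq ι] {κ : Type} [Fintype κ]

/-! ## §1 The mirror window `F(a) ≺ 0 ≺ F(b)` -/

omit [DecidableEq ι] in
/-- Non-negativity propagates upward on a window `F(a) ≺ 0 ≺ F(b)` with one Rayleigh zero per form. [folklore] -/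
theorem propagate_nonneg (d : κ → ℕ) (S : κ → Matrix ι ι ℝ) {a b : ℝ}
    (hFa : ∀ v : ι → ℝ, v ≠ 0 → v ⬝ᵥ ((∑ k, a ^ d k • S k) *ᵥ v) < 0)
    (hFb : ∀ v : ι → ℝ, v ≠ 0 → 0 < v ⬝ᵥ ((∑ k, b ^ d k • S k) *ᵥ v))
    (hone : ∀ v : ι → ℝ, v ≠ 0 → ∀ r₁ r₂ : ℝ, a < r₁ → r₁ < b → a < r₂ → r₂ < b →
      v ⬝ᵥ ((∑ k, r₁ ^ d k • S k) *ᵥ v) = 0 → v ⬝ᵥ ((∑ k, r₂ ^ d k • S k) *ᵥ v) = 0 → r₁ = r₂)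
    (v : ι → ℝ) (hv : v ≠ 0) (s t : ℝ) (has : a ≤ s) (hst : s < t) (htb : t ≤ b)
    (hfs : 0 ≤ v ⬝ᵥ ((fun x : ℝ => ∑ k, x ^ d k • S k) s *ᵥ v)) :
    0 < v ⬝ᵥ ((fun x : ℝ => ∑ k, x ^ d k • S k) t *ᵥ v) := by
  rcases eq_or_lt_of_le htb with rfl | htb'
  · exact hFb v hv
  have has' : a < s := lt_of_le_of_ne has fun e => by
    rw [← e] at hfs; exact absurd (hFa v hv) (not_lt.2 hfs)
  exact scalar_up (continuous_form d S v) (hFa v hv) (hFb v hv) (hone v hv) has' hst htb' hfs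

/-- **The positive index counts the roots** on a window `F(a) ≺ 0 ≺ F(b)`: at every scale `x ∈ (a, b]`,
`π(F(x)) = ∑_{roots t ∈ (a, x)} dim ker F(t)`. [folklore] -/
theorem posIndex_eq_sum_corank_upTo (d : κ → ℕ) (S : κ → Matrix ι ι ℝ) (hS : ∀ k, (S k).IsSymm) {a b x : ℝ}
    (hax : a < x) (hxb : x ≤ b)
    (hFa : ∀ v : ι → ℝ, v ≠ 0 → v ⬝ᵥ ((∑ k, a ^ d k • S k) *ᵥ v) < 0)
    (hFb : ∀ v : ι → ℝ, v ≠ 0 → 0 < v ⬝ᵥ ((∑ k, b ^ d k • S k) *ᵥ v))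
    (hone : ∀ v : ι → ℝ, v ≠ 0 → ∀ r₁ r₂ : ℝ, a < r₁ → r₁ < b → a < r₂ → r₂ < b →
      v ⬝ᵥ ((∑ k, r₁ ^ d k • S k) *ᵥ v) = 0 → v ⬝ᵥ ((∑ k, r₂ ^ d k • S k) *ᵥ v) = 0 → r₁ = r₂) :
    Fintype.card {j // 0 < (Inertia.isHermitian_pencil d S hS x).eigenvalues j}
      = ∑ t ∈ (Matrix.det (∑ k, ((X : ℝ[X]) ^ d k) • (S k).map C)).roots.toFinset.filter (fun t => a < t ∧ t < x),
          (Fintype.card ι - (∑ k, t ^ d k • S k).rank) := by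
  classical
  have hH := Inertia.isHermitian_pencil d S hS
  have hcont := Inertia.continuous_pencil_entry d S
  set P := Matrix.det (∑ k, ((X : ℝ[X]) ^ d k) • (S k).map C) with hP
  have hdetA : (∑ k, a ^ d k • S k).det ≠ 0 := det_ne_zero_of_form_ne_zero fun v hv h => by
    have := hFa v hv; rw [h] at this; exact lt_irrefl 0 this
  have hP0 : P ≠ 0 := fun h => hdetA (by
    have e := eval_det_pencil d S a
    rw [← hP, h, eval_zero] at e
    exact e.symm)
  set T := P.roots.toFinset with hT
  have haT : a ∉ T := fun h => by
    rw [hT, Multiset.mem_toFinset, mem_roots hP0, IsRoot, hP, eval_det_pencil] at h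
    exact hdetA h
  have hIco : T.filter (fun t => a ≤ t ∧ t < x) = T.filter (fun t => a < t ∧ t < x) :=
    Finset.filter_congr fun t ht =>
      ⟨fun h => ⟨lt_of_le_of_ne h.1 (fun e => haT (e ▸ ht)), h.2⟩, fun h => ⟨h.1.le, h.2⟩⟩
  obtain ⟨-, hπa, hra⟩ := indices_of_neg (hH a) hFa
  have hupper := posIndex_add_sum_corank_le_of_directed (fun x : ℝ => ∑ k, x ^ d k • S k) hH T hax
    (fun v hv s t has hst htx hfs => propagate_nonneg d S hFa hFb hone v hv s t has hst (le_trans htx hxb) hfs)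
  have hlower := Inertia.posIndex_le_add_sum_corank (fun x : ℝ => ∑ k, x ^ d k • S k) hcont hH T hax.le
    (fun y _ hy => Inertia.mem_rootSet_of_det_eq_zero d S hP0 hy)
  rw [hIco] at hlower
  beta_reduce at hupper hlower hπa hra
  rw [hπa, hra] at hupper
  rw [hπa] at hlower
  omega

/-- **With multiplicity** (mirror orientation). [folklore] -/
theorem card_roots_upTo_eq_posIndex (d : κ → ℕ) (S : κ → Matrix ι ι ℝ) (hS : ∀ k, (S k).IsSymm) {a b x : ℝ}
    (hax : a < x) (hxb : x ≤ b)
    (hFa : ∀ v : ι → ℝ, v ≠ 0 → v ⬝ᵥ ((∑ k, a ^ d k • S k) *ᵥ v) < 0)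
    (hFb : ∀ v : ι → ℝ, v ≠ 0 → 0 < v ⬝ᵥ ((∑ k, b ^ d k • S k) *ᵥ v))
    (hone : ∀ v : ι → ℝ, v ≠ 0 → ∀ r₁ r₂ : ℝ, a < r₁ → r₁ < b → a < r₂ → r₂ < b →
      v ⬝ᵥ ((∑ k, r₁ ^ d k • S k) *ᵥ v) = 0 → v ⬝ᵥ ((∑ k, r₂ ^ d k • S k) *ᵥ v) = 0 → r₁ = r₂)
    (hsimple : ∀ v : ι → ℝ, v ≠ 0 → ∀ y : ℝ, a < y → y < b →
      v ⬝ᵥ ((∑ k, y ^ d k • S k) *ᵥ v) = 0 →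
        (derivative (∑ k, C (v ⬝ᵥ (S k *ᵥ v)) * (X : ℝ[X]) ^ d k)).eval y ≠ 0) :
    Multiset.card ((Matrix.det (∑ k, ((X : ℝ[X]) ^ d k) • (S k).map C)).roots.filter (fun t => a < t ∧ t < x))
      = Fintype.card {j // 0 < (Inertia.isHermitian_pencil d S hS x).eigenvalues j} := by
  classical
  rw [posIndex_eq_sum_corank_upTo d S hS hax hxb hFa hFb hone, card_filter_eq_sum_count]
  refine Finset.sum_congr rfl fun t ht => ?_
  obtain ⟨-, hat, htx⟩ := Finset.mem_filter.1 ht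
  rw [count_roots, rootMultiplicity_eq_corank_of_simple d S hS hsimple hat (lt_of_lt_of_le htx hxb)]

/-! ## §2 Static inclusion principle for the positive index -/

section Compression

variable {κ' : Type} [Fintype κ'] [DecidableEq κ']

/-- Positive indices of equal matrices agree. [folklore] -/
theorem posIndex_congr {A B : Matrix κ' κ' ℝ} (hA : A.IsHermitian) (hB : B.IsHermitian) (h : A = B) :
    Fintype.card {j // 0 < hA.eigenvalues j} = Fintype.card {j // 0 < hB.eigenvalues j} := by
  subst h
  rfl

/-- **Static inclusion principle, positive index**: `π(G(x)) ≤ π(F(x)) ≤ π(G(x)) + (card ι − card κ')`. [folklore] -/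
theorem posIndex_submatrix_interlace (d : κ → ℕ) (S : κ → Matrix ι ι ℝ) (hS : ∀ k, (S k).IsSymm) (e : κ' → ι)
    (he : Function.Injective e) (x : ℝ) :
    Fintype.card {j // 0 < (Inertia.isHermitian_pencil d (fun k => (S k).submatrix e e)
        (fun k => (hS k).submatrix e) x).eigenvalues j}
      ≤ Fintype.card {i // 0 < (Inertia.isHermitian_pencil d S hS x).eigenvalues i} ∧
    Fintype.card {i // 0 < (Inertia.isHermitian_pencil d S hS x).eigenvalues i}
      ≤ Fintype.card {j // 0 < (Inertia.isHermitian_pencil d (fun k => (S k).submatrix e e)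
          (fun k => (hS k).submatrix e) x).eigenvalues j} + (Fintype.card ι - Fintype.card κ') := by
  classical
  have hF := Inertia.isHermitian_pencil d S hS x
  have htr := posIndex_congr (Inertia.isHermitian_pencil d (fun k => (S k).submatrix e e) (fun k => (hS k).submatrix e) x)
    (hF.submatrix e) (pencil_eval_submatrix d S e x)
  rw [htr]
  have h1 := Literature.Analysis.Matrix.EigenvalueCountOnSubspaces.card_submatrix_eigenvalues_gt_le hF he 0
  have h2 := Literature.Analysis.Matrix.EigenvalueCountOnSubspaces.card_submatrix_eigenvalues_le_le hF he 0
  rw [← Fintype.card_subtype, ← Fintype.card_subtype] at h1 h2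
  have c1 := Inertia.card_nonpos_eigs (hF.submatrix e)
  have c2 := Inertia.card_nonpos_eigs hF
  have l1 := Fintype.card_subtype_le fun j => 0 < (hF.submatrix e).eigenvalues j
  have l2 := Fintype.card_subtype_le fun i => 0 < hF.eigenvalues i
  have hκι : Fintype.card κ' ≤ Fintype.card ι := Fintype.card_le_of_injective e he
  refine ⟨h1, ?_⟩
  rw [c1, c2] at h2
  omega

/-! ## §3 Interlacing, mirror orientation -/

/-- **LACUNARY CAUCHY INTERLACING (mirror orientation, with multiplicity).** [folklore] -/
theorem card_roots_upTo_interlace' (d : κ → ℕ) (S : κ → Matrix ι ι ℝ) (hS : ∀ k, (S k).IsSymm) (e : κ' → ι)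
    (he : Function.Injective e) {a b x : ℝ} (hax : a < x) (hxb : x ≤ b)
    (hFa : ∀ v : ι → ℝ, v ≠ 0 → v ⬝ᵥ ((∑ k, a ^ d k • S k) *ᵥ v) < 0)
    (hFb : ∀ v : ι → ℝ, v ≠ 0 → 0 < v ⬝ᵥ ((∑ k, b ^ d k • S k) *ᵥ v))
    (hone : ∀ v : ι → ℝ, v ≠ 0 → ∀ r₁ r₂ : ℝ, a < r₁ → r₁ < b → a < r₂ → r₂ < b →
      v ⬝ᵥ ((∑ k, r₁ ^ d k • S k) *ᵥ v) = 0 → v ⬝ᵥ ((∑ k, r₂ ^ d k • S k) *ᵥ v) = 0 → r₁ = r₂)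
    (hsimple : ∀ v : ι → ℝ, v ≠ 0 → ∀ y : ℝ, a < y → y < b →
      v ⬝ᵥ ((∑ k, y ^ d k • S k) *ᵥ v) = 0 →
        (derivative (∑ k, C (v ⬝ᵥ (S k *ᵥ v)) * (X : ℝ[X]) ^ d k)).eval y ≠ 0) :
    Multiset.card ((Matrix.det (∑ k, ((X : ℝ[X]) ^ d k) • ((S k).submatrix e e).map C)).roots.filter
        (fun t => a < t ∧ t < x))
      ≤ Multiset.card ((Matrix.det (∑ k, ((X : ℝ[X]) ^ d k) • (S k).map C)).roots.filter (fun t => a < t ∧ t < x)) ∧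
    Multiset.card ((Matrix.det (∑ k, ((X : ℝ[X]) ^ d k) • (S k).map C)).roots.filter (fun t => a < t ∧ t < x))
      ≤ Multiset.card ((Matrix.det (∑ k, ((X : ℝ[X]) ^ d k) • ((S k).submatrix e e).map C)).roots.filter
          (fun t => a < t ∧ t < x)) + (Fintype.card ι - Fintype.card κ') := by
  have hS' : ∀ k, ((S k).submatrix e e).IsSymm := fun k => (hS k).submatrix e
  have hGa : ∀ u : κ' → ℝ, u ≠ 0 → u ⬝ᵥ ((∑ k, a ^ d k • (S k).submatrix e e) *ᵥ u) < 0 := fun u hu => by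
    rw [form_pencil_submatrix d S e he]; exact hFa _ (extend_ne_zero he hu)
  have hGb : ∀ u : κ' → ℝ, u ≠ 0 → 0 < u ⬝ᵥ ((∑ k, b ^ d k • (S k).submatrix e e) *ᵥ u) := fun u hu => by
    rw [form_pencil_submatrix d S e he]; exact hFb _ (extend_ne_zero he hu)
  have honeG : ∀ u : κ' → ℝ, u ≠ 0 → ∀ r₁ r₂ : ℝ, a < r₁ → r₁ < b → a < r₂ → r₂ < b →
      u ⬝ᵥ ((∑ k, r₁ ^ d k • (S k).submatrix e e) *ᵥ u) = 0 →
        u ⬝ᵥ ((∑ k, r₂ ^ d k • (S k).submatrix e e) *ᵥ u) = 0 → r₁ = r₂ := by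
    intro u hu r₁ r₂ h1 h2 h3 h4 hf1 hf2
    rw [form_pencil_submatrix d S e he] at hf1 hf2
    exact hone _ (extend_ne_zero he hu) r₁ r₂ h1 h2 h3 h4 hf1 hf2
  have hsimpleG : ∀ u : κ' → ℝ, u ≠ 0 → ∀ y : ℝ, a < y → y < b →
      u ⬝ᵥ ((∑ k, y ^ d k • (S k).submatrix e e) *ᵥ u) = 0 →
        (derivative (∑ k, C (u ⬝ᵥ ((S k).submatrix e e *ᵥ u)) * (X : ℝ[X]) ^ d k)).eval y ≠ 0 := by
    intro u hu y h1 h2 hf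
    rw [form_pencil_submatrix d S e he] at hf
    have h := hsimple _ (extend_ne_zero he hu) y h1 h2 hf
    have e' : (∑ k, C (u ⬝ᵥ ((S k).submatrix e e *ᵥ u)) * (X : ℝ[X]) ^ d k)
        = ∑ k, C (Function.extend e u 0 ⬝ᵥ (S k *ᵥ Function.extend e u 0)) * (X : ℝ[X]) ^ d k :=
      Finset.sum_congr rfl fun k _ => by rw [form_submatrix _ e he]
    rw [e']
    exact h
  rw [card_roots_upTo_eq_posIndex d S hS hax hxb hFa hFb hone hsimple,
    card_roots_upTo_eq_posIndex d (fun k => (S k).submatrix e e) hS' hax hxb hGa hGb honeG hsimpleG]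
  exact posIndex_submatrix_interlace d S hS e he x

end Compression

/-! ## §4 The sector: interlacing on every gap of `K` alternating definite scales -/

section Sector

variable {κ' : Type} [Fintype κ'] [DecidableEq κ'] {K : ℕ}

/-- **LACUNARY CAUCHY INTERLACING ON THE HYPERBOLIC SECTOR.**  `K ≥ 2` real symmetric letters, `F` definite with alternating
signs at `K` scales `0 < a₀ < ⋯ < a_{K−1}`; `G = F[e,e]` a principal compression (`e : κ' → ι` injective).  Then on every gap
`(aⱼ, aⱼ₊₁)` and at every scale `x ∈ (aⱼ, aⱼ₊₁]`, the numbers `N_G`, `N_F` of roots of `det G`, `det F` in `(aⱼ, x)` COUNTED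
WITH MULTIPLICITY satisfy `N_G ≤ N_F ≤ N_G + (card ι − card κ')`. [folklore] -/
theorem card_roots_gap_upTo_interlace (hK : 2 ≤ K) (d : Fin K → ℕ) (S : Fin K → Matrix ι ι ℝ) (hS : ∀ k, (S k).IsSymm)
    (a : Fin (K - 1 + 1) → ℝ) (ha : StrictMono a) (ha0 : 0 < a 0) (σ : ℝ)
    (hdef : ∀ (j : Fin (K - 1 + 1)) (v : ι → ℝ), v ≠ 0 →
      0 < σ * (-1) ^ (j : ℕ) * (v ⬝ᵥ ((∑ k, a j ^ d k • S k) *ᵥ v)))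
    (e : κ' → ι) (he : Function.Injective e) (j : Fin (K - 1)) {x : ℝ} (hjx : a j.castSucc < x) (hx : x ≤ a j.succ) :
    Multiset.card ((Matrix.det (∑ k, ((X : ℝ[X]) ^ d k) • ((S k).submatrix e e).map C)).roots.filter
        (fun t => a j.castSucc < t ∧ t < x))
      ≤ Multiset.card ((Matrix.det (∑ k, ((X : ℝ[X]) ^ d k) • (S k).map C)).roots.filter
          (fun t => a j.castSucc < t ∧ t < x)) ∧
    Multiset.card ((Matrix.det (∑ k, ((X : ℝ[X]) ^ d k) • (S k).map C)).roots.filter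
        (fun t => a j.castSucc < t ∧ t < x))
      ≤ Multiset.card ((Matrix.det (∑ k, ((X : ℝ[X]) ^ d k) • ((S k).submatrix e e).map C)).roots.filter
          (fun t => a j.castSucc < t ∧ t < x)) + (Fintype.card ι - Fintype.card κ') := by
  classical
  obtain ⟨hFa, hFb⟩ := gap_ends d S a σ hdef j
  have hone := gap_hone hK d S a ha ha0 σ hdef j
  have hsharp := rayleighSharp_of_alternatingScales hK d S a ha ha0 σ hdef
  have hsimple : ∀ v : ι → ℝ, v ≠ 0 → ∀ y : ℝ, a j.castSucc < y → y < a j.succ →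
      v ⬝ᵥ ((∑ k, y ^ d k • S k) *ᵥ v) = 0 →
        (derivative (∑ k, C (v ⬝ᵥ (S k *ᵥ v)) * (X : ℝ[X]) ^ d k)).eval y ≠ 0 :=
    fun v hv y hy _ hfy => eval_derivative_ne_zero_of_sharp hK d S hsharp v hv
      ((ha0.trans_le (ha.monotone (Fin.zero_le _))).trans hy) hfy
  rcases isEmpty_or_nonempty ι with hι | hι
  · -- no vectors at all: both determinants are constants without roots
    have hκ : IsEmpty κ' := ⟨fun k => hι.elim (e k)⟩
    have h1 : (Matrix.det (∑ k, ((X : ℝ[X]) ^ d k) • (S k).map C)) = 1 := Matrix.det_isEmpty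
    have h2 : (Matrix.det (∑ k, ((X : ℝ[X]) ^ d k) • ((S k).submatrix e e).map C)) = 1 := Matrix.det_isEmpty
    rw [h1, h2, roots_one]
    simp
  have hv₀ : (fun _ : ι => (1 : ℝ)) ≠ 0 := fun h => by
    have := congrFun h (Classical.arbitrary ι); simp at this
  set c := σ * (-1) ^ (j : ℕ) with hc
  have hc0 : c ≠ 0 := by
    intro h; have := hFa _ hv₀; rw [h, zero_mul] at this; exact lt_irrefl 0 this
  rcases lt_or_gt_of_ne hc0 with hneg | hpos
  · -- `F(aⱼ) ≺ 0 ≺ F(aⱼ₊₁)`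
    have hFa' : ∀ v : ι → ℝ, v ≠ 0 → v ⬝ᵥ ((∑ k, a j.castSucc ^ d k • S k) *ᵥ v) < 0 :=
      fun v hv => neg_of_mul_pos_left' hneg (hFa v hv)
    have hFb' : ∀ v : ι → ℝ, v ≠ 0 → 0 < v ⬝ᵥ ((∑ k, a j.succ ^ d k • S k) *ᵥ v) := fun v hv => by
      have h := hFb v hv
      rcases mul_neg_iff.1 h with h | h
      · exact absurd h.1 (not_lt.2 hneg.le)
      · exact h.2
    exact card_roots_upTo_interlace' d S hS e he hjx hx hFa' hFb' hone hsimple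
  · -- `F(aⱼ) ≻ 0 ≻ F(aⱼ₊₁)`
    have hFa' : ∀ v : ι → ℝ, v ≠ 0 → 0 < v ⬝ᵥ ((∑ k, a j.castSucc ^ d k • S k) *ᵥ v) :=
      fun v hv => pos_of_mul_pos_left' hpos (hFa v hv)
    have hFb' : ∀ v : ι → ℝ, v ≠ 0 → v ⬝ᵥ ((∑ k, a j.succ ^ d k • S k) *ᵥ v) < 0 := fun v hv => by
      have h := hFb v hv
      rcases mul_neg_iff.1 h with h | h
      · exact h.2
      · exact absurd h.1 (not_lt.2 hpos.le)
    exact card_roots_upTo_interlace d S hS e he hjx hx hFa' hFb' hone hsimple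

/-- **Intrinsic form.**  On a Rayleigh-sharp pencil with strictly increasing exponents the alternating scales exist
(gen 15), so the interlacing holds on every one of its `K − 1` gaps; stated here for the FULL gaps: the compression has between
`card κ' · 1`… precisely, for each gap the root counts with multiplicity are `card κ'` for `G` and `card ι` for `F`
(both exact), consistent with `N_G ≤ N_F ≤ N_G + (card ι − card κ')`. [folklore] -/
theorem card_roots_gap_compression_eq (hK : 2 ≤ K) (d : Fin K → ℕ) (S : Fin K → Matrix ι ι ℝ) (hS : ∀ k, (S k).IsSymm)
    (a : Fin (K - 1 + 1) → ℝ) (ha : StrictMono a) (ha0 : 0 < a 0) (σ : ℝ)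
    (hdef : ∀ (j : Fin (K - 1 + 1)) (v : ι → ℝ), v ≠ 0 →
      0 < σ * (-1) ^ (j : ℕ) * (v ⬝ᵥ ((∑ k, a j ^ d k • S k) *ᵥ v)))
    (e : κ' → ι) (he : Function.Injective e) (j : Fin (K - 1)) :
    Multiset.card ((Matrix.det (∑ k, ((X : ℝ[X]) ^ d k) • ((S k).submatrix e e).map C)).roots.filter
        (fun t => a j.castSucc < t ∧ t < a j.succ)) = Fintype.card κ' := by
  refine card_roots_gap_eq hK d (fun k => (S k).submatrix e e) (fun k => (hS k).submatrix e) a ha ha0 σ ?_ j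
  intro i u hu
  rw [form_pencil_submatrix d S e he]
  exact hdef i _ (extend_ne_zero he hu)

end Sector

end DefiniteMoments

end Summit.ValiantsHypothesis.ValiantsHypothesis.Theorems.LacunarySymmetroidMatrixDescartes
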